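import Summits.HodgeConjecture.HodgeConjecture.Theorems.F0P6aRGDAssemblyDefsInputs   -- ★ previous part of the same Lines workfile `F0_P6a_RGDAssembly` (size-lint split ×3)
import HarnessLib

/-!
# `F0P6aRGDAssemblyDefs` — ★ RE-HOME of `Lines/F0_P6a_RGDAssembly.lean`, PART 3 of 3 (size-lint split; cut at a declaration boundary).

See PART 1 `Theorems/F0P6aRGDAssemblyDefsLetters.lean` for the full re-home header and the original module docstring (verbatim there). Namespaces and sections KEPT
(re-opened below exactly as they stand at the cut, with their `open`∕`variable` lines replayed); code bytes = the workfile՚s, docstrings included; options preamble repeated from PART 1.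
HC_CM is proved only modulo the 7 printed citations (2 remaining: hLiu418 = stmt-HodgeConjecture-24832, h413 = stmt-HodgeConjecture-24833) until rung 0 closes; a re-home is count-neutral. -/

set_option autoImplicit false

noncomputable section

namespace Summit.HodgeConjecture.HodgeConjecture.Cruxes.HLiu418.F0P6aRGDAssembly
set_option linter.dupNamespace false  -- `Summit.HodgeConjecture.HodgeConjecture.…` BY DESIGN (D-0017)
open CategoryTheory CategoryTheory.Limits NumberField IsDedekindDomain MulAction
open scoped Matrix Polynomial Pointwise
open Literature.NumberTheory.GaloisRepresentations
open Literature.NumberTheory.Automorphic Literature.NumberTheory.Automorphic.UnitaryGroup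
open Literature.AlgebraicGeometry.ShimuraVarieties.UnitaryCanonicalModel
open Literature.NumberTheory.Automorphic.Liu2021.AppendixC
open Literature.AlgebraicGeometry.Motives (AlgPoints IntegralModel SchemeOver thickening thickeningGalAction thickeningLift relFrobeniusOver frobSpec)
open Literature.NumberTheory.DiophantineGeometry (geomResidueField specialFibreFunctor)
open Literature.AlgebraicGeometry.RelativeSpec (ActionOver)
open Literature.NumberTheory.EllipticCurves (genericFibre)
open AlgebraicGeometry (QuasiCompact QuasiSeparated LocallyOfFinitePresentation Flat IsSeparated)
open Summit.HodgeConjecture.HodgeConjecture.Cruxes.HLiu418.F0P6aModuliDatumDefs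


/-- **LETTER `RecordDatumOfInputs`** (ED. 3) — the TYPE of `stub_DATUM` AS A NAMED PROPOSITION, token for token: at MH՚s inner binders, under the guards `hunit`∕`hKc`∕`hdisj`,
the localised PEL tuple with its laws gives a moduli datum.  Named so that the parametric head `rgd_of_inputs` and main ED. 7 (`stub_RGD := rgd_of_inputs pel_of_line datum_of_line`)
quote it BY NAME; `stub_DATUM` keeps its registered statement verbatim (the D-line junction `type_of% @stub_DATUM := @datum_of_line` is untouched).  NOT asserted.
(print: Liu2021, Prop. D.8 p. 135, pp. 136–138) (print: RapoportSmithlingZhang2020Diagonal, §4.3 (4.23) p. 21) -/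
def RecordDatumOfInputs : Prop :=
  ∀ (F : Type) [Field F] [NumberField F] [IsCMField F] [IsGalois ℚ F] (ι₁ : F →+* ℂ)
    (Jstar : Matrix (Fin 2) (Fin 2) F)
    (K₀ : C5.OpenCompactSubgroup ↥(finAdelic ↥(maximalRealSubfield F) F (IsCMField.complexConj F) 2 Jstar))
    (S : RecordSystemGS F Jstar ι₁ K₀) (hU7ₛ : S.HeckeTranslateDefinedOver)
    (hJ : (Jstar.map (IsCMField.complexConj F))ᵀ = Jstar) (hJu : IsUnit Jstar)
    (Fi : Type) [Field Fi] [Algebra F Fi] [FiniteDimensional F Fi] [IsGalois F Fi]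
    (Kc : C5.SmallLevel K₀) (G : Type) [Group G] [Finite G]
    (𝓜 : IntegralModel (𝓞 F) F ((thickening F Fi).obj (S.M.obj Kc)))
    (w : HeightOneSpectrum (𝓞 F)) (hw : (IsCMField.complexConj F) • w ≠ w) (h𝓨 : (𝓜.localise w).IsSmoothProper 1)
    (θ : ActionOver (𝓜.localise w).total.hom ((Fi ≃ₐ[F] Fi) × G))
    (_hθ : ∀ γ : Fi ≃ₐ[F] Fi,
       (genericFibre (HeightOneSpectrum.valuationSubringAtPrime F w) F).map
             (Over.isoMk (θ.aut (γ, 1)) (θ.aut_comp (γ, 1))).hom ≫ (𝓜.localise w).genericIso'.hom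
         = (𝓜.localise w).genericIso'.hom ≫
             (Over.isoMk ((thickeningGalAction (L := Fi) (S.M.obj Kc)).aut γ)
               ((thickeningGalAction (L := Fi) (S.M.obj Kc)).aut_comp γ)).hom)
    (e : Fi →ₐ[F] AlgebraicClosure (w.adicCompletion F))
    (_hunit : (UnitaryGroup.isUnit_placeForm Jstar hJu w).unit ∈ glInt 2 (w.adicCompletion F))
    (_hKc : UnitaryGroup.IsHyperspecialAt ↥(maximalRealSubfield F) F (IsCMField.complexConj F) 2 Jstar Kc.1.1
      (w.under (𝓞 ↥(maximalRealSubfield F))))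
    (_hdisj : haveI : AlgebraicGeometry.IsProper (𝓜.localise w).total.hom := h𝓨.2
      ∀ (β : Fi ≃ₐ[F] Fi) (P Q : AlgPoints (S.M.obj Kc) (AlgebraicClosure (w.adicCompletion F))),
        (𝓜.localise w).geomReductionMap (thickeningLift e (S.M.obj Kc) P) =
          AlgPoints.map ((specialFibreFunctor w).map (Over.isoMk (θ.aut (β, 1)) (θ.aut_comp (β, 1))).hom :
              (𝓜.localise w).reductionAt ⟶ (𝓜.localise w).reductionAt)
            ((𝓜.localise w).geomReductionMap (thickeningLift e (S.M.obj Kc) Q)) → β = 1),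
    RGDInputsAt F ι₁ Jstar K₀ S hU7ₛ hJ hJu Fi Kc G 𝓜 w hw h𝓨 θ e →
      Nonempty (ModuliDatum F ι₁ Jstar K₀ S hU7ₛ hJ hJu Fi Kc G 𝓜 w hw h𝓨 θ e)

/-! **SOCKET `stub_DATUM : <the Π-type of `RecordDatumOfInputs`, verbatim>` — NOT IN THE ★ RE-HOME; KEPT IN THE `Lines/` HUB** (ED. 6, same namespace; the D-LINE junction
`type_of% @stub_DATUM := @datum_of_line` in `Lines/F0_P6a_DatumOfInputs.lean` reads it there, unchanged).  Closed BY NAME downstream (D-LINE `F0P6aDatumOfInputs.datum_of_inputs …`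
over the L1∕L2∕L3 closer leaves, read by MAIN ED. 10).  K5-H1. -/

/-! ### §3 HEAD: the letter from the two masses (ED. 3: PARAMETRIC in the two masses, LEAD «M-40») -/

/-- **PARAMETRIC HEAD `rgd_of_inputs (hPEL) (hDATUM) : RecordModuliDatumCofinal`** (ED. 3, LEAD «M-40»; SORRY-FREE, no stub inside) — the letter from ANY proof of the
(vi) mass `RecordPELInputsCofinal` and ANY proof of the (i)–(v) mass `RecordDatumOfInputs`: take GEN՚s choices and, at every good `w`, hyperspecial-`Kc`, `hdisj` and the
localised PEL tuple from `hPEL`; feed the tuple to `hDATUM`.  Main ED. 7 closes `stub_RGD := rgd_of_inputs F0P6aPELInputs.pel_of_line F0P6aDatumOfInputs.datum_of_line` by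
import of the two pay-down leaves; until then `rgd_of_parts` below instantiates it at the two registered stubs.
[cite: RapoportSmithlingZhang2020Diagonal, §4.1 Thm. 4.1 p. 17] [cite: Liu2021, Rem. C.2 p. 108, Lemma C.18 p. 115, proof of Prop. C.20 p. 118] -/
theorem rgd_of_inputs (hPEL : RecordPELInputsCofinal) (hDATUM : RecordDatumOfInputs) : RecordModuliDatumCofinal := by
  intro F _ _ _ _ ι₁ Jstar K₀ S hU7ₛ hJ hJu K
  obtain ⟨Fi, iF, iA, iFD, iG, Kc, hKcK, hn, G, iGr, iFin, φ, hφ, hφker, 𝓜, i1, i2, i3, i4, i5, S_M, hfin, hgood⟩ :=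
    hPEL F ι₁ Jstar K₀ S hU7ₛ hJ hJu K
  refine ⟨Fi, iF, iA, iFD, iG, Kc, hKcK, hn, G, iGr, iFin, φ, hφ, hφker, 𝓜, i1, i2, i3, i4, i5, S_M, hfin, ?_⟩
  intro w hwS hw hunit hK
  obtain ⟨hKc, hinner⟩ := hgood w hwS hw hunit hK
  refine ⟨hKc, fun h𝓨 θ hθ e => ?_⟩
  obtain ⟨hdisj, ⟨I⟩⟩ := hinner h𝓨 θ hθ e
  exact ⟨hdisj, hDATUM F ι₁ Jstar K₀ S hU7ₛ hJ hJu Fi Kc G 𝓜 w hw h𝓨 θ hθ e hunit hKc hdisj I⟩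

/-! **JUNCTION `rgd_of_parts : RecordModuliDatumCofinal := rgd_of_inputs stub_PEL stub_DATUM` — NOT IN THE ★ RE-HOME; KEPT IN THE `Lines/` HUB** (ED. 6, same
namespace), next to the two sockets it instantiates.  The sorry-free PARAMETRIC head `rgd_of_inputs` above is what MAIN reads.  K5-H1. -/

/-! ### §4 THE K∕BT DOCK AT EVERY SPECIAL POINT, from `RGDInputsAt` (census (ii): the 23 K-rows of `BlockReading₀`, sorry-free) -/

section Dock

open AlgebraicGeometry MonoidalCategory CartesianMonoidalCategory Polynomial
open scoped MonObj Obj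
open Literature.AlgebraicGeometry.Motives (relFrobeniusOver frobeniusTwistOver)
open Literature.AlgebraicGeometry.Motives.AbelianVariety (cotangentMap)
open Literature.AlgebraicGeometry.GroupSchemes
open Literature.AlgebraicGeometry.GroupSchemes.AffineGroupScheme (Alg)
open Literature.AlgebraicGeometry.GroupSchemes.GroupSchemeKernel (ker kerι)
open Literature.AlgebraicGeometry.AbelianSchemes Literature.AlgebraicGeometry.AbelianSchemes.AbelianSchemeOver
open Literature.AlgebraicGeometry.AbelianSchemes.AbelianSchemeOver.RingAction
open Literature.AlgebraicGeometry.GroupSchemes.BTGroup Literature.AlgebraicGeometry.GroupSchemes.BTGroup.Hom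
open Literature.AlgebraicGeometry.GroupSchemes.IsRingActionBT
open Literature.AlgebraicGeometry.HodgeTheory Literature.AlgebraicGeometry.HodgeTheory.RingAction
open Literature.RingTheory.DedekindDomain
open Literature.NumberTheory.EllipticCurves (specGenericPoint)
open Literature.NumberTheory.DiophantineGeometry (specResidueField geomResidueFieldEquiv)
open Literature.AlgebraicGeometry.AbelianSchemes.PDivisibleGroupBlockDockingOfLine (blockDocking_of_line)  -- ★ home of the dock (the `Lines` shim՚s `export` namespace is not importable from `Theorems/`; K5-H1 hunk, statement-neutral)

universe u v

-- The clause `jU ≫ F ≫ F^{(q)} = 1` needs the scoped `GrpObj` on the DOUBLE Frobenius twist: it does not synthesise at the default 20 000 in ANY context (fails at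
-- 35 000, passes at 50 000 in isolation); P6d՚s head carries `synthInstance.maxHeartbeats 200000` (tree `F0_P6d_BlockDocking.lean` :89) for the same tokens.
set_option synthInstance.maxHeartbeats 100000 in
/-- **`DockPackage k p f A act w`** — THE CONCLUSION OF THE K∕BT DOCK P6d `blockDocking_of_line` AS ONE NAMED PROPOSITION (ED. 2 cand v3, F0P6-ref1 (g3) o-13 cure (b):
stated ONCE over light variables `k p f A act w` — exactly P6d՚s variable currency — so that neither this file՚s §4 nor the later `stub_DATUM` split re-elaborates the
13-datum ∕ 11-clause `∃` inside the heavy `letI` tower of a special point).  TOKEN FOR TOKEN the conclusion of `blockDocking_of_line` (ED. 7): the `BlockReading₀` rows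
`G₀ grp₀ comm₀ aff₀ fin₀ ι₀G β₀ U₀ grpU₀ affU₀ jU₀ NU₀ θU₀` and the clauses `hι₀G hkerG₀ hβ₀G hβ₀ hU₀ hNU₀ hFFU₀ hrkG₀ hrkF₀ hpts₀ hsimple₀`.  A definition; NOTHING is
asserted by declaring it. [cite: Tate1997FiniteFlatGroupSchemes, (3.7)] [cite: Liu2021, p. 137] -/
def DockPackage (k : Type u) [Field k] (p f : ℕ) [ExpChar k p] (A : AbelianSchemeOver (Spec (.of k)))
    {O : Type v} [CommRing O] (act : RingAction O A) (w : Ideal O) : Prop :=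
  ∃ (G : SchemeOver k) (_ : GrpObj G) (_ : IsCommMonObj G) (_ : IsAffine G.left) (_ : IsFinite G.hom) (ιA : G ⟶ A.X) (βG : O → (G ⟶ G))
    (U : SchemeOver k) (_ : GrpObj U) (_ : IsAffine U.left) (jU : U ⟶ G)
    (NU : ℕ) (_θU : (k[X] ⧸ Ideal.span {(X : k[X]) ^ (p ^ NU)}) ≃ₐ[k] Alg U),
    (IsMonHom ιA ∧ IsClosedImmersion ιA.left) ∧
    (∀ ⦃T : SchemeOver k⦄ (t : T ⟶ A.X), (∀ r ∈ w, t ≫ act.i r = 1) ↔ ∃ s : T ⟶ G, s ≫ ιA = t) ∧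
    (∀ c, βG c ≫ ιA = ιA ≫ act.i c) ∧ (∀ c, IsMonHom (βG c)) ∧
    (IsMonHom jU ∧ IsOpenImmersion jU.left ∧ IsClosedImmersion jU.left ∧ ConnectedSpace ↥U.left) ∧
    (NU = f ∨ NU = f + f) ∧
    jU ≫ relFrobeniusOver p f G ≫ relFrobeniusOver p f (frobeniusTwistOver p f G) = 1 ∧
    Module.finrank k (Alg G) = p ^ f * p ^ f ∧
    Module.finrank k (Alg G ⧸ (RingHom.ker (kerι (relFrobeniusOver p f G)).left.appTop.hom : Ideal (Alg G))) = p ^ f ∧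
    (Nat.card (𝟙_ (SchemeOver k) ⟶ G) = 1 ∨ Nat.card (𝟙_ (SchemeOver k) ⟶ G) = p ^ f) ∧
    ∀ Λ : Subgroup (𝟙_ (SchemeOver k) ⟶ G), (∀ c, ∀ x ∈ Λ, x ≫ βG c ∈ Λ) → Λ = ⊥ ∨ Λ = ⊤

/-- **`dockPackage_of_line`** — P6d `blockDocking_of_line` REPACKED as `DockPackage k p f A act w`, over P6d՚s own binders (sockets (S-H) `hrank`, (S-T) `hsig` verbatim).
[cite: Tate1997FiniteFlatGroupSchemes, (3.7)] [cite: Liu2021, p. 137] -/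
theorem dockPackage_of_line {k : Type u} [Field k] [IsAlgClosed k] (p f : ℕ) [hpr : Fact p.Prime] [CharP k p] [ExpChar k p]
    {A : AbelianSchemeOver (Spec (.of k))} [IsCommMonObj A.X] {g : ℕ} (hg : A.IsOfRelDim g)
    {O : Type v} [CommRing O] [IsDedekindDomain O] (act : RingAction O A)
    (w : Ideal O) [w.IsMaximal] (hw0 : w ≠ ⊥) (hpw : (p : O) ∈ w) (hf : Nat.card (O ⧸ w) = p ^ f)
    {e : ℕ} {𝔟 : Ideal O} (he : 0 < e) (hx : Ideal.span {(p : O)} = w ^ e * 𝔟) (hcop : w ⊔ 𝔟 = ⊤)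
    (a : ℕ → O) (ha1 : ∀ n, a n - 1 ∈ w ^ (e * n)) (ha2 : ∀ n, a n ∈ 𝔟 ^ n)
    (hrank : ∀ n (s : Spec (.of k)),
      (((isRingActionBT_pDivisibleGroupMap act hpr.out.ne_zero hg).homOfCompatibleFamily a
        (sub_mem_span_pow hx hcop ha1 ha2)).fixLayer n).hom.finrank s = p ^ (n * (2 * e * f)))
    (hsig : ∀ n, 0 < n → haveI := act.isMonHom_i (a n);
      Module.finrank k (LinearMap.range (cotangentMap A.toAffine.toAbelianVariety
        (InducedCategory.homMk (Grp.ofHom (A := A.X) (B := A.X) (act.i (a n)))))) = 1) :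
    DockPackage k p f A act w :=
  blockDocking_of_line p f hg act w hw0 hpw hf he hx hcop a ha1 ha2 hrank hsig

/-- **(K-Ω) READ THROUGH `τR_spec`** (o-13 cure (a)): at every `Ω`-point `y` of the thickened generic fibre and every `b ∈ 𝒪_F`, the characteristic polynomial of
`ι(b)` on the cotangent space is `∏_τ (X − τR τ b)^{m τ}` with roots READ IN THE VALUATION RING `R ⊆ Ω` — VERBATIM the `hK` currency of ★ p846836
`hsig_specialFibre_of_isSmoothProper` (index set `Finset.univ`, roots `c τ := τR τ b`). [cite: Kottwitz1992, §5 pp. 389–391] -/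
private theorem RGDInputsAt.charpoly_eq_prod_τR {F : Type} [Field F] [NumberField F] [IsCMField F] {ι₁ : F →+* ℂ}
    {Jstar : Matrix (Fin 2) (Fin 2) F}
    {K₀ : C5.OpenCompactSubgroup ↥(finAdelic ↥(maximalRealSubfield F) F (IsCMField.complexConj F) 2 Jstar)}
    {S : RecordSystemGS F Jstar ι₁ K₀} {hU7ₛ : S.HeckeTranslateDefinedOver}
    {hJ : (Jstar.map (IsCMField.complexConj F))ᵀ = Jstar} {hJu : IsUnit Jstar}
    {Fi : Type} [Field Fi] [Algebra F Fi] {Kc : C5.SmallLevel K₀} {G : Type} [Group G]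
    {𝓜 : IntegralModel (𝓞 F) F ((thickening F Fi).obj (S.M.obj Kc))}
    {w : HeightOneSpectrum (𝓞 F)} {hw : (IsCMField.complexConj F) • w ≠ w} {h𝓨 : (𝓜.localise w).IsSmoothProper 1}
    {θ : ActionOver (𝓜.localise w).total.hom ((Fi ≃ₐ[F] Fi) × G)}
    {e : Fi →ₐ[F] AlgebraicClosure (w.adicCompletion F)}
    (I : RGDInputsAt F ι₁ Jstar K₀ S hU7ₛ hJ hJu Fi Kc G 𝓜 w hw h𝓨 θ e) (b : 𝓞 F) :
    haveI : IsProper (𝓜.localise w).total.hom := h𝓨.2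
    ∀ y : AlgPoints ((thickening F Fi).obj (S.M.obj Kc)) (AlgebraicClosure (w.adicCompletion F)),
    letI ιη := (𝓜.localise w).genericIso'.inv.left ≫
      pullback.fst (𝓜.localise w).total.hom (specGenericPoint (HeightOneSpectrum.valuationSubringAtPrime F w) F)
    haveI := ((I.act.baseChange ιη).baseChange y.left).isMonHom_i b
    (cotangentMap ((I.univ.baseChange ιη).baseChange y.left).toAffine.toAbelianVariety
        (InducedCategory.homMk (Grp.ofHom (A := ((I.univ.baseChange ιη).baseChange y.left).X) (B := ((I.univ.baseChange ιη).baseChange y.left).X)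
          (((I.act.baseChange ιη).baseChange y.left).i b)))).charpoly =
      ∏ τ ∈ (Finset.univ : Finset (F →+* AlgebraicClosure (w.adicCompletion F))),
        (Polynomial.X - Polynomial.C (algebraMap ↥(closureValuationSubring (w.adicCompletion F))
          (AlgebraicClosure (w.adicCompletion F)) (I.τR τ b))) ^ I.m τ := by
  intro y
  refine (I.kottwitzΩ y b).trans (Finset.prod_congr rfl fun τ _ => ?_)
  simp only [ValuationSubring.algebraMap_apply, I.τR_spec]

/-- **THE COUNT `h1` FROM `m_count`** (o-13 cure (a)): for the block idempotent family `a` of `(p) = 𝔭_{c•w}^e · 𝔟` (★ (O-CRT)), `∑_{τ : τR τ (a 1) ≡ 1} m τ = 1` — `m_count`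
read through ★ `map_blockIdempotent_one_eq_one_iff` («`c̄_τ = 1 ↔ τ induces c•w`»); VERBATIM the `h1` currency of ★ p846836.
[cite: RapoportSmithlingZhang2020Diagonal, §4.1 (4.6) p. 16] -/
private theorem RGDInputsAt.sum_m_filter_residue_eq_one {F : Type} [Field F] [NumberField F] [IsCMField F] {ι₁ : F →+* ℂ}
    {Jstar : Matrix (Fin 2) (Fin 2) F}
    {K₀ : C5.OpenCompactSubgroup ↥(finAdelic ↥(maximalRealSubfield F) F (IsCMField.complexConj F) 2 Jstar)}
    {S : RecordSystemGS F Jstar ι₁ K₀} {hU7ₛ : S.HeckeTranslateDefinedOver}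
    {hJ : (Jstar.map (IsCMField.complexConj F))ᵀ = Jstar} {hJu : IsUnit Jstar}
    {Fi : Type} [Field Fi] [Algebra F Fi] {Kc : C5.SmallLevel K₀} {G : Type} [Group G]
    {𝓜 : IntegralModel (𝓞 F) F ((thickening F Fi).obj (S.M.obj Kc))}
    {w : HeightOneSpectrum (𝓞 F)} {hw : (IsCMField.complexConj F) • w ≠ w} {h𝓨 : (𝓜.localise w).IsSmoothProper 1}
    {θ : ActionOver (𝓜.localise w).total.hom ((Fi ≃ₐ[F] Fi) × G)}
    {e : Fi →ₐ[F] AlgebraicClosure (w.adicCompletion F)}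
    (I : RGDInputsAt F ι₁ Jstar K₀ S hU7ₛ hJ hJu Fi Kc G 𝓜 w hw h𝓨 θ e)
    [DecidableEq (IsLocalRing.ResidueField ↥(closureValuationSubring (w.adicCompletion F)))]
    {e' : ℕ} {𝔟 : Ideal (𝓞 F)} (he : 0 < e')
    (hx : Ideal.span {((I.pChar : ℕ) : 𝓞 F)} = ((IsCMField.complexConj F) • w).asIdeal ^ e' * 𝔟)
    (a : ℕ → 𝓞 F) (ha1 : ∀ n, a n - 1 ∈ ((IsCMField.complexConj F) • w).asIdeal ^ (e' * n)) (ha2 : ∀ n, a n ∈ 𝔟 ^ n) :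
    ∑ τ ∈ (Finset.univ : Finset (F →+* AlgebraicClosure (w.adicCompletion F))) with
      IsLocalRing.residue ↥(closureValuationSubring (w.adicCompletion F)) (I.τR τ (a 1)) = 1, I.m τ = 1 := by
  haveI : (((IsCMField.complexConj F) • w).asIdeal).IsMaximal := ((IsCMField.complexConj F) • w).isMaximal
  haveI : CharP (geomResidueField w) I.pChar := I.charP₀
  haveI : CharP (IsLocalRing.ResidueField ↥(closureValuationSubring (w.adicCompletion F))) I.pChar :=
    charP_of_injective_ringHom (geomResidueFieldEquiv w).toRingEquiv.toRingHom.injective I.pChar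
  have hfilter : (Finset.univ : Finset (F →+* AlgebraicClosure (w.adicCompletion F))).filter
      (fun τ => IsLocalRing.residue ↥(closureValuationSubring (w.adicCompletion F)) (I.τR τ (a 1)) = 1) =
      (Finset.univ : Finset (F →+* AlgebraicClosure (w.adicCompletion F))).filter
      (fun τ => RingHom.ker ((IsLocalRing.residue ↥(closureValuationSubring (w.adicCompletion F))).comp (I.τR τ)) =
        (((IsCMField.complexConj F) • w).asIdeal : Ideal (𝓞 F))) :=
    Finset.filter_congr fun τ _ =>
      map_blockIdempotent_one_eq_one_iff
        ((IsLocalRing.residue ↥(closureValuationSubring (w.adicCompletion F))).comp (I.τR τ)) he hx a ha1 ha2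
  rw [hfilter]
  exact I.m_count

-- `TopCat.Presheaf` is not reducible (as in ★ p846766 ∕ p846836 and the P6d junction cert) — scoped to this declaration (cand v3: a section-wide
-- `respectTransparency false` makes the scoped `GrpObj` synthesis on the double Frobenius twist 6× dearer).
set_option backward.isDefEq.respectTransparency false in
/-- **§4 `blockDock_of_inputs` — THE K∕BT DOCK ★ `blockDocking_of_line` AT EVERY SPECIAL POINT `x̄`, EVERY INPUT DISCHARGED FROM THE LOCALISED PEL TUPLE.**
At `k := κ̄(w)`, `A := sch₀Of 𝓜 w I.univ x̄` (= `(I.univ.baseChange ι_s).baseChange x̄.left`), `act := (I.act.baseChange ι_s).baseChange x̄.left`, `O := 𝓞 F`,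
block place `w′ := 𝔭_{c•w}`, `p := I.pChar`, `f := I.fDeg`: the block data `(e, 𝔟, a)` come from ★ (O-CRT) (`exists_eq_pow_mul_coprime` at `p ∈ 𝔭_{c•w}`,
`exists_blockIdempotentFamily`), the socket (S-H) `hrank` from ★ p846766 (`hgF := I.relDim` at `g = [F:ℚ]`), the socket (S-T) `hsig` from ★ p846836 fed with
`hK := I.charpoly_eq_prod_τR (a 1)` and `h1 := I.sum_m_filter_residue_eq_one he hx a ha1 ha2`.  OUTPUT = `DockPackage κ̄(w) p f A act 𝔭_{c•w}` = `blockDocking_of_line`՚s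
13-datum ∕ 11-clause package = the `BlockReading₀` rows `G₀ grp₀ comm₀ aff₀ fin₀ ι₀G β₀ U₀ grpU₀ affU₀ jU₀ NU₀ θU₀` + `hι₀G hkerG₀ hβ₀G hβ₀ hU₀ hFFU₀ hrkG₀ hrkF₀ hpts₀
hsimple₀` at `x̄` (the remaining 8 fields `subEquiv kerF_spec isEtale_spec isogW₀* quot_quot₀ canonicalLine₀` are carrier rows, ED. 3).
[cite: Tate1997FiniteFlatGroupSchemes, (3.7)] [cite: Liu2021, p. 137] [cite: RapoportSmithlingZhang2020Diagonal, §4.1 (4.6) p. 16 and (4.19) p. 19] -/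
theorem blockDock_of_inputs {F : Type} [Field F] [NumberField F] [IsCMField F] {ι₁ : F →+* ℂ}
    {Jstar : Matrix (Fin 2) (Fin 2) F}
    {K₀ : C5.OpenCompactSubgroup ↥(finAdelic ↥(maximalRealSubfield F) F (IsCMField.complexConj F) 2 Jstar)}
    {S : RecordSystemGS F Jstar ι₁ K₀} {hU7ₛ : S.HeckeTranslateDefinedOver}
    {hJ : (Jstar.map (IsCMField.complexConj F))ᵀ = Jstar} {hJu : IsUnit Jstar}
    {Fi : Type} [Field Fi] [Algebra F Fi] {Kc : C5.SmallLevel K₀} {G : Type} [Group G]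
    {𝓜 : IntegralModel (𝓞 F) F ((thickening F Fi).obj (S.M.obj Kc))}
    {w : HeightOneSpectrum (𝓞 F)} {hw : (IsCMField.complexConj F) • w ≠ w} {h𝓨 : (𝓜.localise w).IsSmoothProper 1}
    {θ : ActionOver (𝓜.localise w).total.hom ((Fi ≃ₐ[F] Fi) × G)}
    {e : Fi →ₐ[F] AlgebraicClosure (w.adicCompletion F)}
    (I : RGDInputsAt F ι₁ Jstar K₀ S hU7ₛ hJ hJu Fi Kc G 𝓜 w hw h𝓨 θ e)
    (xbar : AlgPoints (𝓜.localise w).reductionAt (geomResidueField w)) :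
    letI ιs := pullback.fst (𝓜.localise w).total.hom (specResidueField w)
    letI xb : Spec (.of (geomResidueField w)) ⟶ pullback (𝓜.localise w).total.hom (specResidueField w) := xbar.left
    haveI : ExpChar (geomResidueField w) I.pChar := (haveI := I.charP₀; ExpChar.prime I.hpChar.1)
    DockPackage (geomResidueField w) I.pChar I.fDeg ((I.univ.baseChange ιs).baseChange xb) ((I.act.baseChange ιs).baseChange xb)
      ((IsCMField.complexConj F) • w).asIdeal := by
  classical
  -- instances of the place and of the characteristic
  haveI : Fact I.pChar.Prime := ⟨I.hpChar.1⟩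
  haveI : CharP (geomResidueField w) I.pChar := I.charP₀
  haveI : ExpChar (geomResidueField w) I.pChar := ExpChar.prime I.hpChar.1
  haveI : (((IsCMField.complexConj F) • w).asIdeal).IsMaximal := ((IsCMField.complexConj F) • w).isMaximal
  -- commutativity of the group law on the special fibre (abelian scheme over a Noetherian base)
  haveI : IsCommMonObj I.univ.X := I.comm
  haveI : IsLocallyNoetherian (Literature.AlgebraicGeometry.Motives.specOver w.asIdeal.ResidueField (geomResidueField w)).left :=
    inferInstanceAs (IsLocallyNoetherian (Spec (CommRingCat.of (geomResidueField w))))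
  haveI : IsCommMonObj (((I.univ.baseChange (pullback.fst (𝓜.localise w).total.hom (specResidueField w))).baseChange
      (xbar.left : Spec (.of (geomResidueField w)) ⟶ pullback (𝓜.localise w).total.hom (specResidueField w))).X) :=
    AbelianSchemeOver.isCommMonObj_of_isLocallyNoetherian_base _
  -- (O-CRT) block data at `w′ = 𝔭_{c•w}`
  have hw0 : ((IsCMField.complexConj F) • w).asIdeal ≠ ⊥ := ((IsCMField.complexConj F) • w).ne_bot
  have hp0 : ((I.pChar : ℕ) : 𝓞 F) ≠ 0 := Nat.cast_ne_zero.2 I.hpChar.1.ne_zero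
  obtain ⟨e', 𝔟, he, hx, hcop⟩ :=
    exists_eq_pow_mul_coprime ((IsCMField.complexConj F) • w).isPrime hw0 hp0 I.hpCharConj
  obtain ⟨a, ha1, ha2⟩ := exists_blockIdempotentFamily hcop e'
  -- relative dimension `[F:ℚ]`
  have hgF : I.univ.IsOfRelDim (Module.finrank ℚ F) := I.hg ▸ I.relDim
  -- the dock, both sockets by ★, (K-Ω) and the count by the two readings above
  exact dockPackage_of_line I.pChar I.fDeg ((hgF.baseChange _).baseChange _)
    ((I.act.baseChange (pullback.fst (𝓜.localise w).total.hom (specResidueField w))).baseChange xbar.left)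
    ((IsCMField.complexConj F) • w).asIdeal hw0 I.hpCharConj I.hfDeg he hx hcop a ha1 ha2
    (fun n s' => hrank_specialFibre_of_isSmoothProper (𝓜.localise w) h𝓨 hgF I.act (Fact.out : I.pChar.Prime).ne_zero
      ((IsCMField.complexConj F) • w).asIdeal hw0 I.hfDeg hx hcop a ha1 ha2 xbar n s')
    (fun n hn => hsig_specialFibre_of_isSmoothProper (𝓜.localise w) h𝓨 hgF I.act hx hcop a ha1 ha2 Finset.univ
      (fun τ => I.τR τ (a 1)) I.m (I.charpoly_eq_prod_τR (a 1)) (I.sum_m_filter_residue_eq_one he hx a ha1 ha2) xbar n hn)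

end Dock

end Summit.HodgeConjecture.HodgeConjecture.Cruxes.HLiu418.F0P6aRGDAssembly

end
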